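import Literature.NumberTheory.Rogawski1990.LocalTransfer
import Literature.NumberTheory.Rogawski1990.UnramifiedStableOrbitalUnitFactorSemisimple
import Literature.NumberTheory.Automorphic.UnitaryResiduallyRegularNonsplitPlace
import Literature.NumberTheory.Automorphic.UnramifiedOrbitSetAdelic
import Literature.NumberTheory.Automorphic.UnitaryResiduallyRegularOrbitalIntegralUnramifiedPlace
import Literature.NumberTheory.Automorphic.OrbitalMeasureCanonicalExistsCM
import Literature.NumberTheory.Automorphic.OrbitalMeasureCanonicalAtPoint
import HarnessLib

/-!
# [Rogawski1990 §4.9 Prop. 4.9.1 (b)] The unit fundamental lemma at an INERT place on the residually-regular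
# stratum, I: the «`1_K`-collapse» of both sides of (4.3.1)
(Rogawski (1990), §4.3 (4.3.1)–(4.3.2) p. 43, §4.9 Prop. 4.9.1 (b) p. 55; Kottwitz, *Base change for unit
elements of Hecke algebras* (1986), Prop. 7.1, Cor. 7.3)

Topic `NumberTheory/Rogawski1990`; namespace `Literature.NumberTheory.Rogawski1990`. THEOREMS ONLY (no
definition, no instance, no named fact, no `sorry`). Cell `pub/hodgecm-mathlib`, programme P3a, deal
(D1) «N7-inert-L0» of the N7 non-split map of record (A-p06 (g25) 84809157, (L0) «residually-regular
stratum»; LEAD F0P3a-plan (g9) T8-6), cut-holder F0P3b-p01 (g5). HONEST LABEL: HC_CM is proved only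
modulo the 2 remaining named inputs (hLiu418, h413) until rung 0 closes; this file proves NO letter — it
is a PARTIAL discharger, per `γ_H`, of the clause of ★ `IsLocalDeltaTransfer` ∕ `IsLocalUnitTransfer`
(letter N7-ns ★ `UnitFundamentalLemmaExplicitNonsplit`, #103-ns), valid where both unit orbital integrals
collapse to ONE class.

THE PRINT. §4.3 (4.3.1) p. 43: «`Φ^st(γ, f^H) = Δ_{G∕H}(γ) Φ^κ(γ, f)`», with (4.3.2) «`Δ(γ_H, γ′) =
Δ(γ_H, γ) κ(inv(γ, γ′))`» — in the tree's currency (★ `IsDeltaTransferRel`) the clause at `γ_H = a` reads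
`stableOrbitalIntegralRel st mH f^H a = ∑ᶠ c, Δ(a, out c) · Φ(c, f)`. §4.9 Prop. 4.9.1 (b) p. 55: «Suppose
that `E∕F`, `φ` and `μ` are unramified … Then `Δ_{G∕H}(γ)Φ^κ(γ, f) = Φ^st(γ, f^H)` where `f` and `f^H` are
the units of the Hecke algebras». On the residually-regular stratum (Kottwitz 1986, Cor. 7.3: the stable
class of a residually regular integral `γ` meets `K` in ONE `K`-class) both sides have exactly one
non-zero term and the identity is `1 · 1 = 1 · 1`.

THIS FILE (ED. 1, generic — abstract groups `A` («`H`»), `B` («`G`»), any matching relation `R`, any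
«stable conjugacy» `st`, any ★ `TransferFactorData`; the CM-local non-split instance is ED. 2):
* `classOrbitalIntegral_indicator_eq_zero_of_forall_conj_notMem` — a class whose orbit misses `K`
  contributes `Φ(c, 1_K) = 0` (★ `classOrbitalIntegral_eq_zero_of_forall_conj_eq_zero`);
* **`finsum_delta_mul_classOrbitalIntegral_indicator_eq_of_unique`** — the `G`-side:
  `∑ᶠ c, Δ(a, out c) Φ(c, 1_K) = Δ(a, b₀) Φ(⟦b₀⟧, 1_K)` as soon as every `k ∈ K` matching `a` is conjugate
  to `b₀` (the non-split twin of ★ `finsum_delta_mul_classOrbitalIntegral_eq_of_split`, whose uniqueness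
  of the matching class is replaced by uniqueness INSIDE `K`);
* **`stableOrbitalIntegralRel_indicator_eq_classOrbitalIntegral_of_unique`** — the `H`-side:
  `Φ^st(a, 1_{K_H}) = Φ(⟦a⟧, 1_{K_H})` as soon as every `k ∈ K_H` stably conjugate to `a` is conjugate to
  `a` (twin of ★ `stableOrbitalIntegralRel_isLocalStablyConjH_eq_of_split`);
* **`stableOrbitalIntegralRel_indicator_eq_finsum_delta_iff_of_unique`** — under both uniqueness
  binders the clause is EQUIVALENT to the one-term identity `Φ(⟦a⟧, 1_{K_H}) = Δ(a, b₀) Φ(⟦b₀⟧, 1_K)`;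
* **`stableOrbitalIntegralRel_indicator_eq_finsum_delta_of_unique`** — the clause itself from
  `Φ(⟦a⟧, 1_{K_H}) = 1`, `Φ(⟦b₀⟧, 1_K) = 1`, `Δ(a, b₀) = 1`.

## References
* [Rogawski1990] J. D. Rogawski, *Automorphic Representations of Unitary Groups in Three Variables*,
  Ann. of Math. Stud. 123 (1990): §4.3 (4.3.1)–(4.3.2) p. 43; §4.9 Prop. 4.9.1 (b) p. 55; §4.1 (4.1.1) p. 39.
* [Kottwitz1986] R. E. Kottwitz, *Base change for unit elements of Hecke algebras*, Compositio Math. 60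
  (1986): Prop. 7.1, Cor. 7.3.
-/

noncomputable section

open MeasureTheory Measure Set Function NumberField IsDedekindDomain
open Literature.NumberTheory.Automorphic
open scoped Matrix MatrixGroups

namespace Literature.NumberTheory.Rogawski1990

section Generic

variable {A B : Type*} [Group A] [Group B]

/-- The class of a conjugate of `out c` is `c`. [cite: Rogawski1990, §4.1 (4.1.1) p. 39] -/
private theorem mk_conj_out_eq (c : ConjClasses B) (y : B) : ConjClasses.mk (y * Quotient.out c * y⁻¹) = c := by
  rw [← ConjClasses.mk_eq_mk_iff_isConj.2 (isConj_iff.2 ⟨y, rfl⟩)]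
  exact Quotient.out_eq c

/-- **A class whose orbit misses `K` has `Φ(c, 1_K) = 0`** (`1_K : B → ℂ`; any orbital measure family, no
integrability). [cite: Rogawski1990, §4.9 p. 54] -/
theorem classOrbitalIntegral_indicator_eq_zero_of_forall_conj_notMem
    [∀ b : B, MeasurableSpace (B ⧸ Subgroup.centralizer ({b} : Set B))] (m : OrbitalMeasureFamily B) (K : Set B)
    (c : ConjClasses B) (h : ∀ y : B, y * Quotient.out c * y⁻¹ ∉ K) :
    classOrbitalIntegral m (K.indicator fun _ => (1 : ℂ)) c = 0 :=
  classOrbitalIntegral_eq_zero_of_forall_conj_eq_zero m _ c fun y => Set.indicator_of_notMem (h y) _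

/-- **The `G`-side of (4.3.1) at the unit has ONE term when the matching classes meet `K` in one class**:
for a transfer factor `T` supported on `R` (★ `TransferFactorData`: `Δ(a, ·)` vanishes off `R a ·` and is a
class function), any orbital measure family `mG`, `K ⊆ B`, and `b₀ ∈ B` such that every `k ∈ K` matching
`a` is conjugate to `b₀`:
`∑ᶠ c, Δ(a, out c) · Φ(c, 1_K) = Δ(a, b₀) · Φ(⟦b₀⟧, 1_K)` — a class `c ≠ ⟦b₀⟧` either misses `K` (its
orbital integral vanishes) or meets it at `k = y (out c) y⁻¹`, where `Δ(a, k) = Δ(a, out c) ≠ 0` would force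
`R a k`, hence `⟦k⟧ = ⟦b₀⟧`. (Kottwitz's Cor. 7.3 supplies the binder on the residually-regular stratum.)
[cite: Rogawski1990, §4.3 (4.3.1)–(4.3.2) p. 43; §4.9 p. 54] [cite: Kottwitz1986, Cor. 7.3] -/
theorem finsum_delta_mul_classOrbitalIntegral_indicator_eq_of_unique
    [∀ b : B, MeasurableSpace (B ⧸ Subgroup.centralizer ({b} : Set B))] {R : A → B → Prop}
    (T : TransferFactorData A B R) (mG : OrbitalMeasureFamily B) (K : Set B) (a : A) (b₀ : B)
    (huniq : ∀ k ∈ K, R a k → IsConj b₀ k) :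
    ∑ᶠ c : ConjClasses B, T.Δ a (Quotient.out c) * classOrbitalIntegral mG (K.indicator fun _ => (1 : ℂ)) c =
      T.Δ a b₀ * classOrbitalIntegral mG (K.indicator fun _ => (1 : ℂ)) (ConjClasses.mk b₀) := by
  rw [finsum_eq_single (fun c : ConjClasses B =>
    T.Δ a (Quotient.out c) * classOrbitalIntegral mG (K.indicator fun _ => (1 : ℂ)) c) (ConjClasses.mk b₀)]
  · -- the value at `⟦b₀⟧`: `out ⟦b₀⟧ = y b₀ y⁻¹`
    obtain ⟨y, hy⟩ := isConj_iff.1 (ConjClasses.mk_eq_mk_iff_isConj.1 (Quotient.out_eq (ConjClasses.mk b₀)).symm)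
    rw [← hy, T.conj_right]
  · intro c hne
    by_cases hK : ∃ y : B, y * Quotient.out c * y⁻¹ ∈ K
    · obtain ⟨y, hy⟩ := hK
      have hΔ : T.Δ a (Quotient.out c) = 0 := by
        rw [← T.conj_right a (Quotient.out c) y]
        refine T.eq_zero_of_not_rel _ _ fun hrel => hne ?_
        rw [← mk_conj_out_eq c y, ConjClasses.mk_eq_mk_iff_isConj]
        exact (huniq _ hy hrel).symm
      rw [hΔ, zero_mul]
    · push Not at hK
      rw [classOrbitalIntegral_indicator_eq_zero_of_forall_conj_notMem mG K c hK, mul_zero]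

/-- **The `H`-side of (4.3.1) at the unit is ONE orbital integral when the stable class meets `K_H` in one
class**: for a «stable conjugacy» `st` containing conjugacy (`hrefl`) and stable under conjugating its second
argument (`hconj`), any family `mH`, `K_H ⊆ A`, and `a` such that every `k ∈ K_H` with `st a k` is
conjugate to `a`: `Φ^st(a, 1_{K_H}) = Φ(⟦a⟧, 1_{K_H})` (★ `stableOrbitalIntegralRel` is the `finsum` over the
classes `c` with `st a (out c)`; the classes other than `⟦a⟧` miss `K_H`). [cite: Rogawski1990, §4.1 (4.1.1) p. 39; §4.3 p. 43] [cite: Kottwitz1986, Cor. 7.3] -/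
theorem stableOrbitalIntegralRel_indicator_eq_classOrbitalIntegral_of_unique
    [∀ a : A, MeasurableSpace (A ⧸ Subgroup.centralizer ({a} : Set A))] (st : A → A → Prop)
    (mH : OrbitalMeasureFamily A) (KH : Set A) (a : A) (hrefl : ∀ a' : A, IsConj a a' → st a a')
    (hconj : ∀ (b y : A), st a b → st a (y * b * y⁻¹)) (huniq : ∀ k ∈ KH, st a k → IsConj a k) :
    stableOrbitalIntegralRel st mH (KH.indicator fun _ => (1 : ℂ)) a =
      classOrbitalIntegral mH (KH.indicator fun _ => (1 : ℂ)) (ConjClasses.mk a) := by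
  rw [stableOrbitalIntegralRel_def, finsum_mem_def,
    finsum_eq_single (fun c : ConjClasses A => {c : ConjClasses A | st a (Quotient.out c)}.indicator
      (fun c => classOrbitalIntegral mH (KH.indicator fun _ => (1 : ℂ)) c) c) (ConjClasses.mk a)]
  · have hmem : ConjClasses.mk a ∈ {c : ConjClasses A | st a (Quotient.out c)} :=
      hrefl _ (ConjClasses.mk_eq_mk_iff_isConj.1 (Quotient.out_eq (ConjClasses.mk a)).symm)
    exact Set.indicator_of_mem hmem fun c => classOrbitalIntegral mH (KH.indicator fun _ => (1 : ℂ)) c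
  · intro c hne
    by_cases hc : c ∈ {c : ConjClasses A | st a (Quotient.out c)}
    · rw [Set.indicator_of_mem hc]
      refine classOrbitalIntegral_indicator_eq_zero_of_forall_conj_notMem mH KH c fun y hy => hne ?_
      rw [← mk_conj_out_eq c y, ConjClasses.mk_eq_mk_iff_isConj]
      exact (huniq _ hy (hconj _ y hc)).symm
    · exact Set.indicator_of_notMem hc _

/-- **Under both uniqueness binders the clause of (4.3.1) at the units is the ONE-TERM identity**
`Φ(⟦a⟧, 1_{K_H}) = Δ(a, b₀) · Φ(⟦b₀⟧, 1_K)`. [cite: Rogawski1990, §4.3 (4.3.1) p. 43; §4.9 Prop. 4.9.1 (b) p. 55] -/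
theorem stableOrbitalIntegralRel_indicator_eq_finsum_delta_iff_of_unique
    [∀ a : A, MeasurableSpace (A ⧸ Subgroup.centralizer ({a} : Set A))]
    [∀ b : B, MeasurableSpace (B ⧸ Subgroup.centralizer ({b} : Set B))] {R : A → B → Prop} (st : A → A → Prop)
    (T : TransferFactorData A B R) (mH : OrbitalMeasureFamily A) (mG : OrbitalMeasureFamily B)
    (KH : Set A) (K : Set B) (a : A) (b₀ : B) (hrefl : ∀ a' : A, IsConj a a' → st a a')
    (hconj : ∀ (b y : A), st a b → st a (y * b * y⁻¹)) (huniqH : ∀ k ∈ KH, st a k → IsConj a k)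
    (huniqG : ∀ k ∈ K, R a k → IsConj b₀ k) :
    stableOrbitalIntegralRel st mH (KH.indicator fun _ => (1 : ℂ)) a =
        ∑ᶠ c : ConjClasses B, T.Δ a (Quotient.out c) * classOrbitalIntegral mG (K.indicator fun _ => (1 : ℂ)) c ↔
      classOrbitalIntegral mH (KH.indicator fun _ => (1 : ℂ)) (ConjClasses.mk a) =
        T.Δ a b₀ * classOrbitalIntegral mG (K.indicator fun _ => (1 : ℂ)) (ConjClasses.mk b₀) := by
  rw [stableOrbitalIntegralRel_indicator_eq_classOrbitalIntegral_of_unique st mH KH a hrefl hconj huniqH,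
    finsum_delta_mul_classOrbitalIntegral_indicator_eq_of_unique T mG K a b₀ huniqG]

/-- **The clause of (4.3.1) ∕ Prop. 4.9.1 (b) at the units, where both sides collapse and both unit orbital
integrals are `1` and `Δ(a, b₀) = 1`**: `Φ^st(a, 1_{K_H}) = ∑ᶠ c, Δ(a, out c) · Φ(c, 1_K)` (= `1`). This is the
per-`γ_H` body of ★ `IsDeltaTransferRel` ∕ ★ `IsLocalDeltaTransfer` at `f^H = 1_{K_H}`, `f = 1_K`.
[cite: Rogawski1990, §4.9 Prop. 4.9.1 (b) p. 55; §4.3 (4.3.1) p. 43] [cite: Kottwitz1986, Cor. 7.3] -/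
theorem stableOrbitalIntegralRel_indicator_eq_finsum_delta_of_unique
    [∀ a : A, MeasurableSpace (A ⧸ Subgroup.centralizer ({a} : Set A))]
    [∀ b : B, MeasurableSpace (B ⧸ Subgroup.centralizer ({b} : Set B))] {R : A → B → Prop} (st : A → A → Prop)
    (T : TransferFactorData A B R) (mH : OrbitalMeasureFamily A) (mG : OrbitalMeasureFamily B)
    (KH : Set A) (K : Set B) (a : A) (b₀ : B) (hrefl : ∀ a' : A, IsConj a a' → st a a')
    (hconj : ∀ (b y : A), st a b → st a (y * b * y⁻¹)) (huniqH : ∀ k ∈ KH, st a k → IsConj a k)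
    (huniqG : ∀ k ∈ K, R a k → IsConj b₀ k)
    (hH1 : classOrbitalIntegral mH (KH.indicator fun _ => (1 : ℂ)) (ConjClasses.mk a) = 1)
    (hG1 : classOrbitalIntegral mG (K.indicator fun _ => (1 : ℂ)) (ConjClasses.mk b₀) = 1) (hΔ : T.Δ a b₀ = 1) :
    stableOrbitalIntegralRel st mH (KH.indicator fun _ => (1 : ℂ)) a =
      ∑ᶠ c : ConjClasses B, T.Δ a (Quotient.out c) * classOrbitalIntegral mG (K.indicator fun _ => (1 : ℂ)) c := by
  rw [stableOrbitalIntegralRel_indicator_eq_finsum_delta_iff_of_unique st T mH mG KH K a b₀ hrefl hconj huniqH huniqG,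
    hH1, hG1, hΔ, mul_one]

end Generic

end Literature.NumberTheory.Rogawski1990

/-! ## §2 (ED. 2) The CM-local NON-SPLIT place: Kottwitz's STABLE one-class statement and the two
uniqueness binders of §1, discharged on the residually-regular stratum

Carriers `(UnitaryGroup.cmDatum L N H).Local v` (= `UnitaryGroup.«local» L c N H v` by `rfl`, ★
`cmDatum_Local`), `K_v = cmLocalIntegralLevel L N H v = U(H)(𝒪_v)`; frame binders EXACTLY as ★
`UnitaryResiduallyRegularNonsplitPlace` (w1): `w ∣ v` with `c • w = w` (non-split), `v` unramified in `L`,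
`H` `c`-hermitian with good reduction at `w` (`hHw`, `hHi`); residual regularity in the ONE idiom of ★
`UnitaryResiduallyRegularOrbitalIntegralUnramifiedPlace`: the reduced `w`-component matrix
`redMat γ_w` has separable characteristic polynomial. -/

namespace Literature.NumberTheory.Automorphic.UnitaryGroup

open Literature.NumberTheory.Automorphic.IntegralReduction Literature.NumberTheory.Rogawski1990

/-- **Kottwitz's STABLE one-class statement at a non-split place** (Prop. 7.1 ∕ Cor. 7.3): at an
unramified non-split `w ∣ v` of good reduction for `H`, two elements `γ, γ′ ∈ K_v = U(H)(𝒪_v)` with THE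
SAME characteristic polynomial in `GL_N(∏_{w′∣v} L_{w′})`, `γ` residually regular, are conjugate BY AN
ELEMENT OF `K_v` — ★ `integralConj_unitaryGroupOfForm` (whose hypothesis IS equality of characteristic
polynomials) along ★ `localNonsplitEquiv` by ★ `integralConj_of_mulEquiv`; the proof of ★ (w1)
`forall_exists_mem_localIntegralLevel_conj_eq_of_isConj_of_nonsplit` with its conjugacy hypothesis
replaced by the binder `hchar`. [cite: Kottwitz1986, Prop. 7.1, Cor. 7.3] [cite: Rogawski1990, §3.3 p. 21; §4.9 p. 55] -/
theorem exists_mem_cmLocalIntegralLevel_conj_eq_of_charpoly_eq_of_nonsplit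
    (L : Type) [Field L] [NumberField L] [IsCMField L] (N : ℕ) (H : Matrix (Fin N) (Fin N) L)
    {v : HeightOneSpectrum (𝓞 ↥(maximalRealSubfield L))}
    (hc : IsCMField.complexConj L ≠ 1) (hH : (H.map (IsCMField.complexConj L))ᵀ = H)
    (w : PlacesOver L v) (hw : IsCMField.complexConj L • w.1 = w.1) (hv : Algebra.IsUnramifiedIn (𝓞 L) v.asIdeal)
    (hHw : IsUnit (placeForm H w.1)) (hHi : hHw.unit ∈ glInt N (w.1.adicCompletion L))
    {γ γ' : (cmDatum L N H).Local v} (hγ : γ ∈ cmLocalIntegralLevel L N H v)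
    (hγ' : γ' ∈ cmLocalIntegralLevel L N H v)
    (hsep : (redMat ((γ.val : GL (Fin N) (LocalRing L v)).val.map
      (Pi.evalRingHom (fun w' : PlacesOver L v => w'.1.adicCompletion L) w))).charpoly.Separable)
    (hchar : ((γ'.val : GL (Fin N) (LocalRing L v)).val).charpoly =
      ((γ.val : GL (Fin N) (LocalRing L v)).val).charpoly) :
    ∃ k ∈ cmLocalIntegralLevel L N H v, k * γ * k⁻¹ = γ' := by
  have hγint := (mem_localIntegralLevel_iff_of_smul_eq (IsCMField.complexConj L) N H hc w hw γ).1 hγ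
  have hγ'int := (mem_localIntegralLevel_iff_of_smul_eq (IsCMField.complexConj L) N H hc w hw γ').1 hγ'
  refine integralConj_of_mulEquiv (localNonsplitEquiv (IsCMField.complexConj L) H hc w hw).toMulEquiv
    (cmLocalIntegralLevel L N H v)
    ((glInt N (w.1.adicCompletion L)).subgroupOf
      (unitaryGroupOfForm (galAdicCompletionMap (L := L) (IsCMField.complexConj L) hw) (placeForm H w.1)))
    (fun u => by
      rw [Subgroup.mem_subgroupOf]
      exact mem_localIntegralLevel_iff_of_smul_eq (IsCMField.complexConj L) N H hc w hw u) γ γ' ?_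
  exact integralConj_unitaryGroupOfForm (IsCMField.complexConj L) N H hc hH w hw hv hHw hHi _ hγint
    (exists_integral_lift_separable_of_separable_redMat N w _ hγint
      (by rw [coe_coe_localNonsplitEquiv_apply]; exact hsep)) _ hγ'int
    (by
      change (((localNonsplitEquiv (IsCMField.complexConj L) H hc w hw γ' :
          unitaryGroupOfForm (galAdicCompletionMap (L := L) (IsCMField.complexConj L) hw) (placeForm H w.1)) :
          GL (Fin N) (w.1.adicCompletion L)) : Matrix (Fin N) (Fin N) (w.1.adicCompletion L)).charpoly =
        (((localNonsplitEquiv (IsCMField.complexConj L) H hc w hw γ :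
          unitaryGroupOfForm (galAdicCompletionMap (L := L) (IsCMField.complexConj L) hw) (placeForm H w.1)) :
          GL (Fin N) (w.1.adicCompletion L)) : Matrix (Fin N) (Fin N) (w.1.adicCompletion L)).charpoly
      rw [charpoly_coe_localNonsplitEquiv, charpoly_coe_localNonsplitEquiv, hchar])

/-- Conjugate elements of `GL_n(R)` have the same characteristic polynomial (Mathlib
`Matrix.charpoly_units_conj`). [cite: Rogawski1990, §3.1 p. 19] -/
private theorem charpoly_eq_of_isConj_gl {n R : Type*} [Fintype n] [DecidableEq n] [CommRing R]
    {a b : GL n R} (h : IsConj a b) : (b.val : Matrix n n R).charpoly = (a.val : Matrix n n R).charpoly := by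
  obtain ⟨g, hg⟩ := isConj_iff.1 h
  have h1 := Matrix.charpoly_units_conj g (a.val : Matrix n n R)
  rw [← hg, Units.val_mul, Units.val_mul, Matrix.coe_units_inv]
  exact h1

/-- **The `G`-side uniqueness binder of §1 DISCHARGED at a non-split place**: at an unramified non-split
`w ∣ v` of good reduction for `H′`, if `γ₀ ∈ K′_v = U(H′)(𝒪_v)` is residually regular and matches `γ_H`
(★ `IsLocalNormPair`, i.e. `ι_v(γ_H)` and `γ₀` are conjugate in `GL₃(∏_{w′∣v} L_{w′})`), then EVERY `k ∈ K′_v`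
matching `γ_H` is conjugate to `γ₀` in `U(H′)(L⁺_v)` (same characteristic polynomial, then the stable
one-class statement) — the `huniq` of ★ `finsum_delta_mul_classOrbitalIntegral_indicator_eq_of_unique`.
[cite: Kottwitz1986, Cor. 7.3] [cite: Rogawski1990, §4.9 p. 54; §14.1 p. 232] -/
theorem isConj_of_isLocalNormPair_of_mem_cmLocalIntegralLevel_of_nonsplit
    (L : Type) [Field L] [NumberField L] [IsCMField L] (H' : Matrix (Fin 3) (Fin 3) L)
    {v : HeightOneSpectrum (𝓞 ↥(maximalRealSubfield L))}
    (hc : IsCMField.complexConj L ≠ 1) (hH' : (H'.map (IsCMField.complexConj L))ᵀ = H')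
    (w : PlacesOver L v) (hw : IsCMField.complexConj L • w.1 = w.1) (hv : Algebra.IsUnramifiedIn (𝓞 L) v.asIdeal)
    (hH'w : IsUnit (placeForm H' w.1)) (hH'i : hH'w.unit ∈ glInt 3 (w.1.adicCompletion L))
    {γH : (cmDatum L 2 (Matrix.of fun i j : Fin 2 => if i.val + j.val + 1 = 2 then (1 : L) else 0)).Local v ×
      (cmDatum L 1 (Matrix.of fun i j : Fin 1 => if i.val + j.val + 1 = 1 then (1 : L) else 0)).Local v}
    {γ₀ k : (cmDatum L 3 H').Local v} (hγ₀ : γ₀ ∈ cmLocalIntegralLevel L 3 H' v)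
    (hsep₀ : (redMat ((γ₀.val : GL (Fin 3) (LocalRing L v)).val.map
      (Pi.evalRingHom (fun w' : PlacesOver L v => w'.1.adicCompletion L) w))).charpoly.Separable)
    (h₀ : IsLocalNormPair L H' v γH γ₀) (hk : k ∈ cmLocalIntegralLevel L 3 H' v)
    (hk' : IsLocalNormPair L H' v γH k) : IsConj γ₀ k := by
  have hGL : IsConj (γ₀.val : GL (Fin 3) (LocalRing L v)) (k.val : GL (Fin 3) (LocalRing L v)) :=
    (IsConj.symm h₀).trans hk'
  obtain ⟨u, -, hu⟩ := exists_mem_cmLocalIntegralLevel_conj_eq_of_charpoly_eq_of_nonsplit L 3 H' hc hH' w hw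
    hv hH'w hH'i hγ₀ hk hsep₀ (charpoly_eq_of_isConj_gl hGL)
  exact isConj_iff.2 ⟨u, hu⟩

/-- **The `H`-side uniqueness binder of §1 DISCHARGED at a non-split place**: on the pair group
`H_v = U(Φ₂)(L⁺_v) × U(Φ₁)(L⁺_v)` with `K_H = U(Φ₂)(𝒪_v) ×ˢ U(Φ₁)(𝒪_v)`, at an unramified non-split `w ∣ v`
of good reduction for both factors: if `γ_H ∈ K_H` has residually regular components, EVERY `k ∈ K_H`
stably conjugate to `γ_H` (★ `IsLocalStablyConjH`: componentwise `GL`-conjugacy) is conjugate to `γ_H`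
in `H_v` (componentwise stable one-class statement) — the `huniq` of ★
`stableOrbitalIntegralRel_indicator_eq_classOrbitalIntegral_of_unique`. [cite: Kottwitz1986, Cor. 7.3] [cite: Rogawski1990, §3.1 p. 19; §4.9 p. 55] -/
theorem isConj_of_isLocalStablyConjH_of_mem_prod_of_nonsplit
    (L : Type) [Field L] [NumberField L] [IsCMField L] {v : HeightOneSpectrum (𝓞 ↥(maximalRealSubfield L))}
    (hc : IsCMField.complexConj L ≠ 1) (w : PlacesOver L v) (hw : IsCMField.complexConj L • w.1 = w.1)
    (hv : Algebra.IsUnramifiedIn (𝓞 L) v.asIdeal)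
    (hΦ₂ : ((Matrix.of fun i j : Fin 2 => if i.val + j.val + 1 = 2 then (1 : L) else 0).map (IsCMField.complexConj L))ᵀ =
      Matrix.of fun i j : Fin 2 => if i.val + j.val + 1 = 2 then (1 : L) else 0)
    (hΦ₂w : IsUnit (placeForm (Matrix.of fun i j : Fin 2 => if i.val + j.val + 1 = 2 then (1 : L) else 0) w.1))
    (hΦ₂i : hΦ₂w.unit ∈ glInt 2 (w.1.adicCompletion L))
    (hΦ₁ : ((Matrix.of fun i j : Fin 1 => if i.val + j.val + 1 = 1 then (1 : L) else 0).map (IsCMField.complexConj L))ᵀ =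
      Matrix.of fun i j : Fin 1 => if i.val + j.val + 1 = 1 then (1 : L) else 0)
    (hΦ₁w : IsUnit (placeForm (Matrix.of fun i j : Fin 1 => if i.val + j.val + 1 = 1 then (1 : L) else 0) w.1))
    (hΦ₁i : hΦ₁w.unit ∈ glInt 1 (w.1.adicCompletion L))
    {γH k : (cmDatum L 2 (Matrix.of fun i j : Fin 2 => if i.val + j.val + 1 = 2 then (1 : L) else 0)).Local v ×
      (cmDatum L 1 (Matrix.of fun i j : Fin 1 => if i.val + j.val + 1 = 1 then (1 : L) else 0)).Local v}
    (hγH : γH ∈ (cmLocalIntegralLevel L 2 (Matrix.of fun i j : Fin 2 => if i.val + j.val + 1 = 2 then (1 : L) else 0) v).prod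
      (cmLocalIntegralLevel L 1 (Matrix.of fun i j : Fin 1 => if i.val + j.val + 1 = 1 then (1 : L) else 0) v))
    (hsep₂ : (redMat ((γH.1.val : GL (Fin 2) (LocalRing L v)).val.map
      (Pi.evalRingHom (fun w' : PlacesOver L v => w'.1.adicCompletion L) w))).charpoly.Separable)
    (hsep₁ : (redMat ((γH.2.val : GL (Fin 1) (LocalRing L v)).val.map
      (Pi.evalRingHom (fun w' : PlacesOver L v => w'.1.adicCompletion L) w))).charpoly.Separable)
    (hk : k ∈ (cmLocalIntegralLevel L 2 (Matrix.of fun i j : Fin 2 => if i.val + j.val + 1 = 2 then (1 : L) else 0) v).prod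
      (cmLocalIntegralLevel L 1 (Matrix.of fun i j : Fin 1 => if i.val + j.val + 1 = 1 then (1 : L) else 0) v))
    (hst : IsLocalStablyConjH L v γH k) : IsConj γH k := by
  obtain ⟨u₂, -, hu₂⟩ := exists_mem_cmLocalIntegralLevel_conj_eq_of_charpoly_eq_of_nonsplit L 2 _ hc hΦ₂ w hw hv
    hΦ₂w hΦ₂i (Subgroup.mem_prod.1 hγH).1 (Subgroup.mem_prod.1 hk).1 hsep₂ (charpoly_eq_of_isConj_gl hst.1)
  obtain ⟨u₁, -, hu₁⟩ := exists_mem_cmLocalIntegralLevel_conj_eq_of_charpoly_eq_of_nonsplit L 1 _ hc hΦ₁ w hw hv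
    hΦ₁w hΦ₁i (Subgroup.mem_prod.1 hγH).2 (Subgroup.mem_prod.1 hk).2 hsep₁ (charpoly_eq_of_isConj_gl hst.2)
  exact isConj_iff.2 ⟨(u₂, u₁), Prod.ext hu₂ hu₁⟩

/-- **The `hrefl` ∕ `hconj` binders of §1 for ★ `IsLocalStablyConjH`**: conjugates are stably conjugate,
and stable conjugacy is stable under conjugating its second argument. [cite: Rogawski1990, §3.1 p. 19] -/
theorem isLocalStablyConjH_of_isConj_and_conj (L : Type) [Field L] [NumberField L] [IsCMField L]
    {v : HeightOneSpectrum (𝓞 ↥(maximalRealSubfield L))}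
    (γH : (cmDatum L 2 (Matrix.of fun i j : Fin 2 => if i.val + j.val + 1 = 2 then (1 : L) else 0)).Local v ×
      (cmDatum L 1 (Matrix.of fun i j : Fin 1 => if i.val + j.val + 1 = 1 then (1 : L) else 0)).Local v) :
    (∀ a', IsConj γH a' → IsLocalStablyConjH L v γH a') ∧
      ∀ b y, IsLocalStablyConjH L v γH b → IsLocalStablyConjH L v γH (y * b * y⁻¹) :=
  ⟨fun _ h => isStablyConjH_of_isConj h,
    fun _ y h => IsStablyConjH.trans h (isStablyConjH_of_isConj (isConj_iff.2 ⟨y, rfl⟩))⟩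

end Literature.NumberTheory.Automorphic.UnitaryGroup

/-! ## §3 (ED. 3) The clause of (4.3.1) ∕ Prop. 4.9.1 (b) at the units, at a NON-SPLIT unramified place
of good reduction, for a residually regular `γ_H` — the per-`γ_H` atom of ★ `IsLocalUnitTransfer`

For ANY local transfer factor `T` (★ `LocalTransferFactor`), canonical families `mH`, `mG` (★
`OrbitalMeasureFamily.IsCanonical`, any predicates `P_H`, `P_G` holding at the two representatives) and
Haar measures with `νH(K_H) = νG(K′) = 1`: the displayed equation of ★ `isLocalDeltaTransfer_iff` at
`fH = 1_{K_H}`, `f = 1_{K′}` holds at every `γ_H ∈ K_H` which is `G`-regular with residually separable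
`U(Φ₂)`-component, GIVEN an integral match `γ₀ ∈ K′` (residually separable) with `Δ(γ_H, γ₀) = 1`.
BINDERS LEFT (named, hypothesis-driven): `h₀ ∕ hγ₀` (existence of an INTEGRAL matching class in the inner
form — integral equivalence of `w`-unimodular hermitian forms, ★ `UnitaryGroupSelfDualLocus`; automatic
a.e. in `v` for rational classes) and `hΔ` (the value `Δ‴_v(γ_H, γ₀) = 1` on the stratum, deal (D2)). -/

namespace Literature.NumberTheory.Rogawski1990

open Literature.NumberTheory.Automorphic.UnitaryGroup Literature.NumberTheory.Automorphic.IntegralReduction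

/-- **THE UNIT FUNDAMENTAL LEMMA ON THE RESIDUALLY-REGULAR STRATUM AT A NON-SPLIT PLACE, PER `γ_H`**:
at a finite place `v` of `L⁺` unramified and non-split in `L` (`c • w = w`), of good reduction for `H′`,
for any local transfer factor `T`, canonical `mH`, `mG` with `νH(K_H) = νG(K′) = 1`, a `G`-regular
`γ_H ∈ K_H = U(Φ₂)(𝒪_v) ×ˢ U(Φ₁)(𝒪_v)` with residually separable `U(Φ₂)`-component, and an integral match
`γ₀ ∈ K′ = U(H′)(𝒪_v)` of `γ_H`, residually separable, with `Δ(γ_H, γ₀) = 1`: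
`Φ^st(γ_H, 1_{K_H}) = ∑ᶠ c, Δ(γ_H, out c) · Φ(c, 1_{K′})` — the body of ★ `isLocalDeltaTransfer_iff` at
this `γ_H` (both sides equal `1`: §1 with the binders of §2, the two unit values by ★
`IsCanonical.classOrbitalIntegral_mk_eq_orbitalIntegral` + ★ `orbitalIntegral_indicator_eq_of_single_conjClass_of_compactCore`
fed by ★ ED. 4 `UnitaryResiduallyRegularOrbitalIntegralUnramifiedPlace` (`hK1`, `hcore`) and ★
`OrbitalMeasureCanonicalExistsCM` (the normalised torus measures)). A PARTIAL discharger of letter N7-ns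
(stratum `disc ∈ 𝒪ˣ`; the letter quantifies over all `G`-regular `γ_H`). [cite: Rogawski1990, §4.9 Prop. 4.9.1 (b) p. 55; §4.3 (4.3.1) p. 43] [cite: Kottwitz1986, Prop. 7.1, Cor. 7.3] -/
theorem stableOrbitalIntegralRel_indicator_eq_finsum_delta_of_separable_redMat_of_nonsplit
    (L : Type) [Field L] [NumberField L] [IsCMField L] (H' : Matrix (Fin 3) (Fin 3) L)
    (hH' : (H'.map (IsCMField.complexConj L))ᵀ = H') (hH'd : IsUnit H'.det)
    {v : HeightOneSpectrum (𝓞 ↥(maximalRealSubfield L))} (w : PlacesOver L v)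
    (hw : IsCMField.complexConj L • w.1 = w.1) (hv : Algebra.IsUnramifiedIn (𝓞 L) v.asIdeal)
    (hH'w : IsUnit (placeForm H' w.1)) (hH'i : hH'w.unit ∈ glInt 3 (w.1.adicCompletion L))
    [MeasurableSpace ((cmDatum L 3 H').Local v)] [BorelSpace ((cmDatum L 3 H').Local v)]
    [∀ γ : ((cmDatum L 3 H').Local v), MeasurableSpace (((cmDatum L 3 H').Local v) ⧸ Subgroup.centralizer ({γ} : Set ((cmDatum L 3 H').Local v)))]
    [∀ γ : ((cmDatum L 3 H').Local v), BorelSpace (((cmDatum L 3 H').Local v) ⧸ Subgroup.centralizer ({γ} : Set ((cmDatum L 3 H').Local v)))]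
    [MeasurableSpace ((cmDatum L 2 (Matrix.of fun i j : Fin 2 => if i.val + j.val + 1 = 2 then (1 : L) else 0)).Local v ×
      (cmDatum L 1 (Matrix.of fun i j : Fin 1 => if i.val + j.val + 1 = 1 then (1 : L) else 0)).Local v)]
    [BorelSpace ((cmDatum L 2 (Matrix.of fun i j : Fin 2 => if i.val + j.val + 1 = 2 then (1 : L) else 0)).Local v ×
      (cmDatum L 1 (Matrix.of fun i j : Fin 1 => if i.val + j.val + 1 = 1 then (1 : L) else 0)).Local v)]
    [∀ a : ((cmDatum L 2 (Matrix.of fun i j : Fin 2 => if i.val + j.val + 1 = 2 then (1 : L) else 0)).Local v ×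
      (cmDatum L 1 (Matrix.of fun i j : Fin 1 => if i.val + j.val + 1 = 1 then (1 : L) else 0)).Local v),
      MeasurableSpace (((cmDatum L 2 (Matrix.of fun i j : Fin 2 => if i.val + j.val + 1 = 2 then (1 : L) else 0)).Local v ×
      (cmDatum L 1 (Matrix.of fun i j : Fin 1 => if i.val + j.val + 1 = 1 then (1 : L) else 0)).Local v) ⧸ Subgroup.centralizer ({a} : Set ((cmDatum L 2 (Matrix.of fun i j : Fin 2 => if i.val + j.val + 1 = 2 then (1 : L) else 0)).Local v ×
      (cmDatum L 1 (Matrix.of fun i j : Fin 1 => if i.val + j.val + 1 = 1 then (1 : L) else 0)).Local v)))]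
    [∀ a : ((cmDatum L 2 (Matrix.of fun i j : Fin 2 => if i.val + j.val + 1 = 2 then (1 : L) else 0)).Local v ×
      (cmDatum L 1 (Matrix.of fun i j : Fin 1 => if i.val + j.val + 1 = 1 then (1 : L) else 0)).Local v),
      BorelSpace (((cmDatum L 2 (Matrix.of fun i j : Fin 2 => if i.val + j.val + 1 = 2 then (1 : L) else 0)).Local v ×
      (cmDatum L 1 (Matrix.of fun i j : Fin 1 => if i.val + j.val + 1 = 1 then (1 : L) else 0)).Local v) ⧸ Subgroup.centralizer ({a} : Set ((cmDatum L 2 (Matrix.of fun i j : Fin 2 => if i.val + j.val + 1 = 2 then (1 : L) else 0)).Local v ×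
      (cmDatum L 1 (Matrix.of fun i j : Fin 1 => if i.val + j.val + 1 = 1 then (1 : L) else 0)).Local v)))]
    (νH : Measure ((cmDatum L 2 (Matrix.of fun i j : Fin 2 => if i.val + j.val + 1 = 2 then (1 : L) else 0)).Local v ×
      (cmDatum L 1 (Matrix.of fun i j : Fin 1 => if i.val + j.val + 1 = 1 then (1 : L) else 0)).Local v)) [νH.IsHaarMeasure] [νH.IsMulRightInvariant]
    (νG : Measure ((cmDatum L 3 H').Local v)) [νG.IsHaarMeasure] [νG.IsMulRightInvariant]
    (T : LocalTransferFactor L H' v)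
    {P_H : ((cmDatum L 2 (Matrix.of fun i j : Fin 2 => if i.val + j.val + 1 = 2 then (1 : L) else 0)).Local v ×
      (cmDatum L 1 (Matrix.of fun i j : Fin 1 => if i.val + j.val + 1 = 1 then (1 : L) else 0)).Local v) → Prop} {P_G : ((cmDatum L 3 H').Local v) → Prop}
    {mH : OrbitalMeasureFamily ((cmDatum L 2 (Matrix.of fun i j : Fin 2 => if i.val + j.val + 1 = 2 then (1 : L) else 0)).Local v ×
      (cmDatum L 1 (Matrix.of fun i j : Fin 1 => if i.val + j.val + 1 = 1 then (1 : L) else 0)).Local v)} {mG : OrbitalMeasureFamily ((cmDatum L 3 H').Local v)}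
    (hmH : mH.IsCanonical P_H νH) (hmG : mG.IsCanonical P_G νG)
    (hνH : νH ((((cmLocalIntegralLevel L 2 (Matrix.of fun i j : Fin 2 => if i.val + j.val + 1 = 2 then (1 : L) else 0) v).prod
      (cmLocalIntegralLevel L 1 (Matrix.of fun i j : Fin 1 => if i.val + j.val + 1 = 1 then (1 : L) else 0) v)) : Subgroup ((cmDatum L 2 (Matrix.of fun i j : Fin 2 => if i.val + j.val + 1 = 2 then (1 : L) else 0)).Local v ×
      (cmDatum L 1 (Matrix.of fun i j : Fin 1 => if i.val + j.val + 1 = 1 then (1 : L) else 0)).Local v)) : Set ((cmDatum L 2 (Matrix.of fun i j : Fin 2 => if i.val + j.val + 1 = 2 then (1 : L) else 0)).Local v ×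
      (cmDatum L 1 (Matrix.of fun i j : Fin 1 => if i.val + j.val + 1 = 1 then (1 : L) else 0)).Local v)) = 1)
    (hνG : νG (cmLocalIntegralLevel L 3 H' v : Set ((cmDatum L 3 H').Local v)) = 1)
    {γH : ((cmDatum L 2 (Matrix.of fun i j : Fin 2 => if i.val + j.val + 1 = 2 then (1 : L) else 0)).Local v ×
      (cmDatum L 1 (Matrix.of fun i j : Fin 1 => if i.val + j.val + 1 = 1 then (1 : L) else 0)).Local v)}
    (hγH : γH ∈ ((cmLocalIntegralLevel L 2 (Matrix.of fun i j : Fin 2 => if i.val + j.val + 1 = 2 then (1 : L) else 0) v).prod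
      (cmLocalIntegralLevel L 1 (Matrix.of fun i j : Fin 1 => if i.val + j.val + 1 = 1 then (1 : L) else 0) v))) (hreg : IsLocalGRegular L v γH)
    (hPH : P_H (Quotient.out (ConjClasses.mk γH)))
    (hsep₂ : (redMat ((γH.1.val : GL (Fin 2) (LocalRing L v)).val.map
      (Pi.evalRingHom (fun w' : PlacesOver L v => w'.1.adicCompletion L) w))).charpoly.Separable)
    {γ₀ : ((cmDatum L 3 H').Local v)} (hγ₀ : γ₀ ∈ cmLocalIntegralLevel L 3 H' v) (h₀ : IsLocalNormPair L H' v γH γ₀)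
    (hPG : P_G (Quotient.out (ConjClasses.mk γ₀)))
    (hsep₀ : (redMat ((γ₀.val : GL (Fin 3) (LocalRing L v)).val.map
      (Pi.evalRingHom (fun w' : PlacesOver L v => w'.1.adicCompletion L) w))).charpoly.Separable)
    (hΔ : T.Δ γH γ₀ = 1) :
    stableOrbitalIntegralRel (IsLocalStablyConjH L v) mH
        (((((cmLocalIntegralLevel L 2 (Matrix.of fun i j : Fin 2 => if i.val + j.val + 1 = 2 then (1 : L) else 0) v).prod
      (cmLocalIntegralLevel L 1 (Matrix.of fun i j : Fin 1 => if i.val + j.val + 1 = 1 then (1 : L) else 0) v)) : Subgroup ((cmDatum L 2 (Matrix.of fun i j : Fin 2 => if i.val + j.val + 1 = 2 then (1 : L) else 0)).Local v ×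
      (cmDatum L 1 (Matrix.of fun i j : Fin 1 => if i.val + j.val + 1 = 1 then (1 : L) else 0)).Local v)) : Set ((cmDatum L 2 (Matrix.of fun i j : Fin 2 => if i.val + j.val + 1 = 2 then (1 : L) else 0)).Local v ×
      (cmDatum L 1 (Matrix.of fun i j : Fin 1 => if i.val + j.val + 1 = 1 then (1 : L) else 0)).Local v)).indicator fun _ => (1 : ℂ)) γH =
      ∑ᶠ c : ConjClasses ((cmDatum L 3 H').Local v), T.Δ γH (Quotient.out c) *
        classOrbitalIntegral mG ((cmLocalIntegralLevel L 3 H' v : Set ((cmDatum L 3 H').Local v)).indicator fun _ => (1 : ℂ)) c := by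
  obtain ⟨γ₂, γ₁⟩ := γH
  have hc := IsCMField.complexConj_ne_one L
  -- the frame of the quasi-split forms `Φ₂`, `Φ₁`: hermitian, hyperspecial at every place, unit determinant
  have hΦ₂ := antidiagOne_map_transpose (IsCMField.complexConj L) 2
  have hΦ₁ := antidiagOne_map_transpose (IsCMField.complexConj L) 1
  have hΦ₂w := isUnit_placeForm_antidiagOne (E := L) 2 w.1
  have hΦ₂i := unit_placeForm_antidiagOne_mem_glInt (E := L) 2 w.1
  have hΦ₁w := isUnit_placeForm_antidiagOne (E := L) 1 w.1
  have hΦ₁i := unit_placeForm_antidiagOne_mem_glInt (E := L) 1 w.1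
  have hΦ₂d : IsUnit (Matrix.of fun i j : Fin 2 => if i.val + j.val + 1 = 2 then (1 : L) else 0).det := by
    have h : (Matrix.of fun i j : Fin 2 => if i.val + j.val + 1 = 2 then (1 : L) else 0) = !![0, 1; 1, 0] := by
      ext i j; fin_cases i <;> fin_cases j <;> rfl
    rw [h, Matrix.det_fin_two_of]; norm_num
  have hΦ₁d : IsUnit (Matrix.of fun i j : Fin 1 => if i.val + j.val + 1 = 1 then (1 : L) else 0).det := by
    rw [Matrix.det_fin_one, Matrix.of_apply]; norm_num
  -- the `U(Φ₁)`-component is automatically residually regular (`1 × 1`)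
  have hsep₁ : (redMat ((γ₁.val : GL (Fin 1) (LocalRing L v)).val.map
      (Pi.evalRingHom (fun w' : PlacesOver L v => w'.1.adicCompletion L) w))).charpoly.Separable := by
    rw [Matrix.charpoly, Matrix.det_fin_one, Matrix.charmatrix_apply_eq]
    exact Polynomial.separable_X_sub_C
  -- regularity of `γ₂`, `γ₁`, `γ₀` in `GL(∏ L_{w′})`, and of their `w`-components
  have h3 : IsRegularElt ((endoEmbLocal L v (γ₂, γ₁)).val : GL (Fin 3) (LocalRing L v)) := hreg
  have hreg₀ : IsRegularElt (γ₀.val : GL (Fin 3) (LocalRing L v)) := isRegularElt_of_isConj h₀ h3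
  rw [isRegularElt_iff, coe_endoEmbLocal, charpoly_endoGL] at h3
  have hreg₂ : IsRegularElt (γ₂.val : GL (Fin 2) (LocalRing L v)) := h3.of_mul_left
  have hreg₁ : IsRegularElt (γ₁.val : GL (Fin 1) (LocalRing L v)) := isRegularElt_of_fin_one _
  have hγs₂ : ((γ₂.val : GL (Fin 2) (LocalRing L v)).val.map
      (Pi.evalRingHom (fun w' : PlacesOver L v => w'.1.adicCompletion L) w)).charpoly.Separable := by
    rw [Matrix.charpoly_map]; exact ((isRegularElt_iff _).1 hreg₂).map
  have hγs₁ : ((γ₁.val : GL (Fin 1) (LocalRing L v)).val.map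
      (Pi.evalRingHom (fun w' : PlacesOver L v => w'.1.adicCompletion L) w)).charpoly.Separable := by
    rw [Matrix.charpoly_map]; exact ((isRegularElt_iff _).1 hreg₁).map
  have hγs₀ : ((γ₀.val : GL (Fin 3) (LocalRing L v)).val.map
      (Pi.evalRingHom (fun w' : PlacesOver L v => w'.1.adicCompletion L) w)).charpoly.Separable := by
    rw [Matrix.charpoly_map]; exact ((isRegularElt_iff _).1 hreg₀).map
  refine stableOrbitalIntegralRel_indicator_eq_finsum_delta_of_unique (IsLocalStablyConjH L v) T mH mG _ _
    (γ₂, γ₁) γ₀ (isLocalStablyConjH_of_isConj_and_conj L (γ₂, γ₁)).1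
    (isLocalStablyConjH_of_isConj_and_conj L (γ₂, γ₁)).2
    (fun k hk hst => isConj_of_isLocalStablyConjH_of_mem_prod_of_nonsplit L hc w hw hv hΦ₂ hΦ₂w hΦ₂i hΦ₁
      hΦ₁w hΦ₁i hγH hsep₂ hsep₁ hk hst)
    (fun k hk hk' => isConj_of_isLocalNormPair_of_mem_cmLocalIntegralLevel_of_nonsplit L H' hc hH' w hw hv
      hH'w hH'i hγ₀ hsep₀ h₀ hk hk') ?_ ?_ hΔ
  · -- the `H`-side unit value `Φ(⟦γ_H⟧, 1_{K_H}) = 1`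
    haveI : IsClosed ((Subgroup.centralizer ({(γ₂, γ₁)} : Set ((cmDatum L 2 (Matrix.of fun i j : Fin 2 => if i.val + j.val + 1 = 2 then (1 : L) else 0)).Local v × (cmDatum L 1 (Matrix.of fun i j : Fin 1 => if i.val + j.val + 1 = 1 then (1 : L) else 0)).Local v)) :
        Subgroup ((cmDatum L 2 (Matrix.of fun i j : Fin 2 => if i.val + j.val + 1 = 2 then (1 : L) else 0)).Local v × (cmDatum L 1 (Matrix.of fun i j : Fin 1 => if i.val + j.val + 1 = 1 then (1 : L) else 0)).Local v)) : Set ((cmDatum L 2 (Matrix.of fun i j : Fin 2 => if i.val + j.val + 1 = 2 then (1 : L) else 0)).Local v × (cmDatum L 1 (Matrix.of fun i j : Fin 1 => if i.val + j.val + 1 = 1 then (1 : L) else 0)).Local v)) :=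
      isClosed_coe_centralizer_singleton _
    haveI : BorelSpace ↥(Subgroup.centralizer ({(γ₂, γ₁)} : Set ((cmDatum L 2 (Matrix.of fun i j : Fin 2 => if i.val + j.val + 1 = 2 then (1 : L) else 0)).Local v × (cmDatum L 1 (Matrix.of fun i j : Fin 1 => if i.val + j.val + 1 = 1 then (1 : L) else 0)).Local v))) := Subtype.borelSpace _
    haveI : SecondCountableTopology ↥(Subgroup.centralizer ({(γ₂, γ₁)} : Set ((cmDatum L 2 (Matrix.of fun i j : Fin 2 => if i.val + j.val + 1 = 2 then (1 : L) else 0)).Local v × (cmDatum L 1 (Matrix.of fun i j : Fin 1 => if i.val + j.val + 1 = 1 then (1 : L) else 0)).Local v))) :=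
      TopologicalSpace.Subtype.secondCountableTopology _
    haveI : LocallyCompactSpace ↥(Subgroup.centralizer ({(γ₂, γ₁)} : Set ((cmDatum L 2 (Matrix.of fun i j : Fin 2 => if i.val + j.val + 1 = 2 then (1 : L) else 0)).Local v × (cmDatum L 1 (Matrix.of fun i j : Fin 1 => if i.val + j.val + 1 = 1 then (1 : L) else 0)).Local v))) :=
      (isClosed_coe_centralizer_singleton (γ₂, γ₁)).isClosedEmbedding_subtypeVal.locallyCompactSpace
    have f₂ := compactCore_centralizer_local_facts_of_isRegularElt (IsCMField.complexConj L) 2 _ hc hΦ₂ hΦ₂d γ₂ hreg₂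
    have f₁ := compactCore_centralizer_local_facts_of_isRegularElt (IsCMField.complexConj L) 1 _ hc hΦ₁ hΦ₁d γ₁ hreg₁
    obtain ⟨tH, htH, htHi, htH1⟩ :
        ∃ t : Measure ↥(Subgroup.centralizer ({(γ₂, γ₁)} : Set ((cmDatum L 2 (Matrix.of fun i j : Fin 2 => if i.val + j.val + 1 = 2 then (1 : L) else 0)).Local v × (cmDatum L 1 (Matrix.of fun i j : Fin 1 => if i.val + j.val + 1 = 1 then (1 : L) else 0)).Local v))),
          t.IsHaarMeasure ∧ t.IsInvInvariant ∧
            t (compactCore ↥(Subgroup.centralizer ({(γ₂, γ₁)} : Set ((cmDatum L 2 (Matrix.of fun i j : Fin 2 => if i.val + j.val + 1 = 2 then (1 : L) else 0)).Local v × (cmDatum L 1 (Matrix.of fun i j : Fin 1 => if i.val + j.val + 1 = 1 then (1 : L) else 0)).Local v)))) = 1 := by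
      refine exists_isHaarMeasure_compactCore_centralizer_prod_eq_one
        (A := (cmDatum L 2 (Matrix.of fun i j : Fin 2 => if i.val + j.val + 1 = 2 then (1 : L) else 0)).Local v)
        (B := (cmDatum L 1 (Matrix.of fun i j : Fin 1 => if i.val + j.val + 1 = 1 then (1 : L) else 0)).Local v) γ₂ γ₁ ?_ ?_ ?_ ?_ ?_ ?_
      · exact f₂.1
      · exact f₁.1
      · exact f₂.2.1
      · exact f₂.2.2
      · exact f₁.2.1
      · exact f₁.2.2
    haveI := htH
    haveI := htHi
    rw [hmH.classOrbitalIntegral_mk_eq_orbitalIntegral hPH tH htH1, orbitalIntegral_indicator_complex_eq_ofReal,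
      orbitalIntegral_indicator_eq_of_single_conjClass_of_compactCore _ _ tH νH
        (isCompact_isOpen_cmLocalIntegralLevel_prod L 2 1 (Matrix.of fun i j : Fin 2 => if i.val + j.val + 1 = 2 then (1 : L) else 0)
          (Matrix.of fun i j : Fin 1 => if i.val + j.val + 1 = 1 then (1 : L) else 0) v).2
        (isCompact_isOpen_cmLocalIntegralLevel_prod L 2 1 (Matrix.of fun i j : Fin 2 => if i.val + j.val + 1 = 2 then (1 : L) else 0)
          (Matrix.of fun i j : Fin 1 => if i.val + j.val + 1 = 1 then (1 : L) else 0) v).1 hγH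
        (forall_exists_mem_cmLocalIntegralLevel_prod_conj_eq_of_separable_redMat L 2 1 _ _ hc hΦ₂ hΦ₁ w hv hΦ₂w
          hΦ₁w hΦ₂i hΦ₁i hγH hsep₂ hsep₁)
        (setOf_mem_cmLocalIntegralLevel_prod_eq_compactCore_of_separable_redMat L 2 1 _ _ hc hΦ₂ hΦ₁ w hΦ₂w hΦ₁w
          hΦ₂i hΦ₁i hγH hγs₂ hsep₂ hγs₁ hsep₁) htH1,
      hνH, ENNReal.toReal_one, Complex.ofReal_one]
  · -- the `G`-side unit value `Φ(⟦γ₀⟧, 1_{K′}) = 1`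
    haveI : IsClosed ((Subgroup.centralizer ({γ₀} : Set ((cmDatum L 3 H').Local v)) : Subgroup ((cmDatum L 3 H').Local v)) : Set ((cmDatum L 3 H').Local v)) :=
      isClosed_coe_centralizer_singleton _
    haveI : BorelSpace ↥(Subgroup.centralizer ({γ₀} : Set ((cmDatum L 3 H').Local v))) := Subtype.borelSpace _
    haveI : SecondCountableTopology ↥(Subgroup.centralizer ({γ₀} : Set ((cmDatum L 3 H').Local v))) :=
      TopologicalSpace.Subtype.secondCountableTopology _
    haveI : LocallyCompactSpace ↥(Subgroup.centralizer ({γ₀} : Set ((cmDatum L 3 H').Local v))) :=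
      (isClosed_coe_centralizer_singleton γ₀).isClosedEmbedding_subtypeVal.locallyCompactSpace
    letI : MeasurableSpace («local» L (IsCMField.complexConj L) 3 H' v) := ‹MeasurableSpace ((cmDatum L 3 H').Local v)›
    haveI : BorelSpace («local» L (IsCMField.complexConj L) 3 H' v) := ‹BorelSpace ((cmDatum L 3 H').Local v)›
    obtain ⟨tG, htG, htGi, htG1⟩ :
        ∃ t : Measure ↥(Subgroup.centralizer ({γ₀} : Set ((cmDatum L 3 H').Local v))),
          t.IsHaarMeasure ∧ t.IsInvInvariant ∧ t (compactCore ↥(Subgroup.centralizer ({γ₀} : Set ((cmDatum L 3 H').Local v)))) = 1 :=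
      forall_isRegularElt_exists_isHaarMeasure_compactCore_centralizer_local_eq_one (IsCMField.complexConj L) 3 H'
        hc hH' hH'd γ₀ hreg₀
    haveI := htG
    haveI := htGi
    rw [hmG.classOrbitalIntegral_mk_eq_orbitalIntegral hPG tG htG1, orbitalIntegral_indicator_complex_eq_ofReal,
      orbitalIntegral_indicator_eq_of_single_conjClass_of_compactCore _ (cmLocalIntegralLevel L 3 H' v) tG νG
        (isCompact_isOpen_cmLocalIntegralLevel L 3 H' v).2 (isCompact_isOpen_cmLocalIntegralLevel L 3 H' v).1 hγ₀
        (forall_exists_mem_cmLocalIntegralLevel_conj_eq_of_separable_redMat L 3 H' hc hH' w hv hH'w hH'i hγ₀ hsep₀)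
        (setOf_mem_cmLocalIntegralLevel_eq_compactCore_of_separable_redMat L 3 H' hc hH' w hH'w hH'i hγ₀ hγs₀ hsep₀)
        htG1,
      hνG, ENNReal.toReal_one, Complex.ofReal_one]

end Literature.NumberTheory.Rogawski1990
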